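import Mathlib
import Summits.Ventures.PercRepro2.PointSplitSourceLeaf

/-!
# The point-split forms hold for PRINCIPAL up-sets on product spaces
(blind cell PercRepro2, night-3 g23, 2026-08-28; `proofs/NIGHT3-CERT.md` §32.17)

Abstract setting: a product law `p` on `Config E`, monotone observables, and the principal up-set
`A_S = {ω | ∀ i ∈ S, ω i = true}` (`prinEvent`).  The (PS1)-shaped form
`M(1_A, 1) = E[FG·1_A] + E[FG]·P(A) − E[F·1_A]·E[G] − E[F]·E[G·1_A]` is NOT nonnegative for arbitrary
increasing events `A` (unions of principal up-sets fail, §32.4), but for principal `A` it is — and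
so is the nested mixed version with `F₀ ≤ F₁`, `G₀ ≤ G₁`:

  `N_S(F₁, G₁; F₀, G₀) = E[F₁G₁·1_A] + E[F₀G₀]·P(A) − E[F₁·1_A]·E[G₀] − E[F₀]·E[G₁·1_A] ≥ 0`

(`nestedForm_nonneg`, induction on `S` by pinning one coordinate at a time: the step
`N_{S ∪ {i}}(p) = p_i·[p_i·N_S(p[i:=1]; F₁, G₁; F₀, G₀) + (1 − p_i)·N_S(p[i:=1]; F₁, G₁; F₀∘[i:=0], G₀∘[i:=0])]`,
the base `S = ∅` being Harris twice plus `(E F₁ − E F₀)(E G₁ − E G₀) ≥ 0`).  Consequences: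
`pointSplitOne_principal` ((PS1)-shape, `F₁ = F₀`) and `pointSplit_principal` ((PS)-shape
`M(1_A, 1_{Ā}) ≥ 0`, by the same induction with the (PS1)-nested form as the cross term).  In
percolation terms: `{v ∈ C_s}` is principal exactly when the `s`–`v` path is unique (trees), so the
candidates (PS)/(PS1) without avoidance hold on trees for every `v`.  Own work; standard axioms.
-/

namespace Summit.Ventures.PercRepro2

open UnionCluster

namespace CovForm

namespace PointSplit

variable {E : Type*} [Fintype E] [DecidableEq E]
  {R : Type*} [Field R] [LinearOrder R] [IsStrictOrderedRing R]

/-- The principal up-set `{ω | ∀ i ∈ S, ω i = true}`. -/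
def prinEvent (S : Finset E) : Set (Config E) := {ω | ∀ i ∈ S, ω i = true}

omit [Fintype E] [DecidableEq E] [LinearOrder R] [IsStrictOrderedRing R] in
/-- `A_∅` is everything. -/
lemma indicator_prinEvent_empty (ω : Config E) :
    (prinEvent (∅ : Finset E)).indicator (1 : Config E → R) ω = 1 := by
  rw [Set.indicator_of_mem (show ω ∈ prinEvent ∅ from fun i hi => absurd hi (Finset.notMem_empty i))]
  rfl

omit [Fintype E] [LinearOrder R] [IsStrictOrderedRing R] in
/-- `1_{A_{S ∪ {i}}} = 1_{A_S} · [ω i = true]`. -/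
lemma indicator_prinEvent_insert {i : E} {S : Finset E} (ω : Config E) :
    (prinEvent (insert i S)).indicator (1 : Config E → R) ω =
      (prinEvent S).indicator 1 ω * (if ω i = true then 1 else 0) := by
  by_cases hi : ω i = true
  · by_cases hS : ω ∈ prinEvent S
    · have h : ω ∈ prinEvent (insert i S) := by
        intro j hj
        rcases Finset.mem_insert.1 hj with rfl | hj
        · exact hi
        · exact hS j hj
      rw [Set.indicator_of_mem h, Set.indicator_of_mem hS]
      simp [hi]
    · have h : ω ∉ prinEvent (insert i S) := fun h => hS fun j hj => h j (Finset.mem_insert_of_mem hj)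
      rw [Set.indicator_of_notMem h, Set.indicator_of_notMem hS]
      simp
  · have h : ω ∉ prinEvent (insert i S) := fun h => hi (h i (Finset.mem_insert_self i S))
    rw [Set.indicator_of_notMem h]
    simp [hi]

omit [Fintype E] [LinearOrder R] [IsStrictOrderedRing R] in
/-- For `i ∉ S`, `1_{A_S}` does not see the coordinate `i`. -/
lemma indicator_prinEvent_update {i : E} {S : Finset E} (hi : i ∉ S) (ω : Config E) (b : Bool) :
    (prinEvent S).indicator (1 : Config E → R) (Function.update ω i b) =
      (prinEvent S).indicator 1 ω := by
  have key : Function.update ω i b ∈ prinEvent S ↔ ω ∈ prinEvent S := by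
    constructor
    · intro h j hj
      have hji : j ≠ i := fun hji => hi (by rw [← hji]; exact hj)
      have := h j hj
      rwa [Function.update_of_ne hji] at this
    · intro h j hj
      have hji : j ≠ i := fun hji => hi (by rw [← hji]; exact hj)
      rw [Function.update_of_ne hji]
      exact h j hj
  by_cases h : ω ∈ prinEvent S
  · rw [Set.indicator_of_mem h, Set.indicator_of_mem (key.2 h)]
    rfl
  · rw [Set.indicator_of_notMem h, Set.indicator_of_notMem (fun h' => h (key.1 h'))]

/-- The nested mixed point-split form
`N_S(F₁, G₁; F₀, G₀) = E[F₁G₁·1_A] + E[F₀G₀]·P(A) − E[F₁·1_A]·E[G₀] − E[F₀]·E[G₁·1_A]`. -/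
noncomputable def nestedForm (p : E → R) (S : Finset E) (F₁ G₁ F₀ G₀ : Config E → R) : R :=
  expect p (fun ω => F₁ ω * G₁ ω * (prinEvent S).indicator 1 ω) +
      expect p (fun ω => F₀ ω * G₀ ω) * expect p (fun ω => (prinEvent S).indicator 1 ω) -
    expect p (fun ω => F₁ ω * (prinEvent S).indicator 1 ω) * expect p G₀ -
    expect p F₀ * expect p (fun ω => G₁ ω * (prinEvent S).indicator 1 ω)

omit [Fintype E] [LinearOrder R] [IsStrictOrderedRing R] in
/-- `ω[i := false] ≤ ω`. -/
lemma update_false_le (ω : Config E) (i : E) : Function.update ω i false ≤ ω := by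
  intro j
  by_cases hj : j = i
  · subst hj; simp
  · simp [Function.update_of_ne hj]

omit [LinearOrder R] [IsStrictOrderedRing R] in
/-- Composing with `[i := false]` under the law pinned open at `i` is the law pinned closed. -/
lemma expect_update_one_comp_update_false (p : E → R) (i : E) (X : Config E → R) :
    expect (Function.update p i 1) (fun ω => X (Function.update ω i false)) =
      expect (Function.update p i 0) X := by
  rw [expect_update_one, expect_update_zero]
  refine congrArg _ (funext fun ω => ?_)
  rw [Function.update_idem]

omit [Fintype E] [Field R] [IsStrictOrderedRing R] in
/-- `X ∘ [i := false]` is monotone for monotone `X`. -/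
lemma monotone_comp_update_false {X : Config E → R} (hX : Monotone X) (i : E) :
    Monotone (fun ω => X (Function.update ω i false)) := by
  intro ω ω' h
  refine hX fun j => ?_
  by_cases hj : j = i
  · subst hj; simp
  · simp only [Function.update_of_ne hj]; exact h j

/-- **The nested mixed point-split form is nonnegative for principal up-sets** (induction on `S`,
one coordinate pinned at a time). -/
theorem nestedForm_nonneg (S : Finset E) :
    ∀ (p : E → R), IsProbVec p → ∀ (F₁ G₁ F₀ G₀ : Config E → R), Monotone F₁ → Monotone G₁ →
      Monotone F₀ → Monotone G₀ → (∀ ω, F₀ ω ≤ F₁ ω) → (∀ ω, G₀ ω ≤ G₁ ω) →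
        0 ≤ nestedForm p S F₁ G₁ F₀ G₀ := by
  induction S using Finset.induction_on with
  | empty =>
    intro p hp F₁ G₁ F₀ G₀ h1 h2 h3 h4 h10 h20
    unfold nestedForm
    simp only [indicator_prinEvent_empty, mul_one, expect_const]
    have hc1 := expect_mul_expect_le_expect_mul hp h1 h2
    have hc0 := expect_mul_expect_le_expect_mul hp h3 h4
    have ha := expect_mono hp h10
    have hb := expect_mono hp h20
    have e1 : expect p (fun ω => F₁ ω * G₁ ω) = expect p (F₁ * G₁) := rfl
    have e0 : expect p (fun ω => F₀ ω * G₀ ω) = expect p (F₀ * G₀) := rfl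
    rw [e1, e0]
    nlinarith [hc1, hc0, ha, hb]
  | insert i S hi ih =>
    intro p hp F₁ G₁ F₀ G₀ h1 h2 h3 h4 h10 h20
    have hp₁ : IsProbVec (Function.update p i 1) := hp.update i zero_le_one le_rfl
    have hq0 := hp.nonneg i
    have hq1 := hp.le_one i
    -- the two instances of the induction hypothesis under the law pinned open at `i`
    have ih₁ := ih (Function.update p i 1) hp₁ F₁ G₁ F₀ G₀ h1 h2 h3 h4 h10 h20
    have ih₂ := ih (Function.update p i 1) hp₁ F₁ G₁ (fun ω => F₀ (Function.update ω i false))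
      (fun ω => G₀ (Function.update ω i false)) h1 h2 (monotone_comp_update_false h3 i)
      (monotone_comp_update_false h4 i)
      (fun ω => le_trans (h3 (update_false_le ω i)) (h10 ω))
      (fun ω => le_trans (h4 (update_false_le ω i)) (h20 ω))
    unfold nestedForm at ih₁ ih₂ ⊢
    rw [expect_update_one_comp_update_false p i (fun ω => F₀ ω * G₀ ω),
      expect_update_one_comp_update_false p i F₀,
      expect_update_one_comp_update_false p i G₀] at ih₂
    -- pin the coordinate `i` in the eight expectations
    simp only [indicator_prinEvent_insert, ← mul_assoc]
    rw [expect_mul_open_eq p i (fun ω => F₁ ω * G₁ ω * (prinEvent S).indicator 1 ω),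
      expect_mul_open_eq p i (fun ω => (prinEvent S).indicator 1 ω),
      expect_mul_open_eq p i (fun ω => F₁ ω * (prinEvent S).indicator 1 ω),
      expect_mul_open_eq p i (fun ω => G₁ ω * (prinEvent S).indicator 1 ω),
      expect_eq_pin p (fun ω => F₀ ω * G₀ ω) i, expect_eq_pin p G₀ i, expect_eq_pin p F₀ i]
    set q := p i
    set u₁ := expect (Function.update p i 1) (fun ω => F₁ ω * G₁ ω * (prinEvent S).indicator 1 ω)
    set P := expect (Function.update p i 1) (fun ω => (prinEvent S).indicator 1 ω)
    set a₁ := expect (Function.update p i 1) (fun ω => F₁ ω * (prinEvent S).indicator 1 ω)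
    set c₁ := expect (Function.update p i 1) (fun ω => G₁ ω * (prinEvent S).indicator 1 ω)
    set w₁ := expect (Function.update p i 1) (fun ω => F₀ ω * G₀ ω)
    set w₀ := expect (Function.update p i 0) (fun ω => F₀ ω * G₀ ω)
    set b₁ := expect (Function.update p i 1) F₀
    set b₀ := expect (Function.update p i 0) F₀
    set d₁ := expect (Function.update p i 1) G₀
    set d₀ := expect (Function.update p i 0) G₀
    have key : q * u₁ + (q * w₁ + (1 - q) * w₀) * (q * P) - q * a₁ * (q * d₁ + (1 - q) * d₀) -
        (q * b₁ + (1 - q) * b₀) * (q * c₁) =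
        q * (q * (u₁ + w₁ * P - a₁ * d₁ - b₁ * c₁) + (1 - q) * (u₁ + w₀ * P - a₁ * d₀ - b₀ * c₁)) := by
      ring
    rw [key]
    exact mul_nonneg hq0 (add_nonneg (mul_nonneg hq0 ih₁) (mul_nonneg (by linarith) ih₂))

/-- **(PS1)-shape for principal up-sets**: `E[FG·1_A] + E[FG]·P(A) ≥ E[F·1_A]·E[G] + E[F]·E[G·1_A]`
for monotone `F, G` and `A = A_S`. -/
theorem pointSplitOne_principal {p : E → R} (hp : IsProbVec p) (S : Finset E)
    {F G : Config E → R} (hF : Monotone F) (hG : Monotone G) :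
    expect p (fun ω => F ω * (prinEvent S).indicator 1 ω) * expect p G +
        expect p F * expect p (fun ω => G ω * (prinEvent S).indicator 1 ω) ≤
      expect p (fun ω => F ω * G ω * (prinEvent S).indicator 1 ω) +
        expect p (fun ω => F ω * G ω) * expect p (fun ω => (prinEvent S).indicator 1 ω) := by
  have h := nestedForm_nonneg S p hp F G F G hF hG hF hG (fun _ => le_rfl) (fun _ => le_rfl)
  unfold nestedForm at h
  linarith [h]

/-- The nested mixed split form
`N⁻_S(F₁, G₁; F₀, G₀) = E[F₁G₁·1_A]·P(Ā) + E[F₀G₀·1_Ā]·P(A) − E[F₁·1_A]·E[G₀·1_Ā] − E[F₀·1_Ā]·E[G₁·1_A]`,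
with `1_Ā = 1 − 1_A`. -/
noncomputable def splitForm (p : E → R) (S : Finset E) (F₁ G₁ F₀ G₀ : Config E → R) : R :=
  expect p (fun ω => F₁ ω * G₁ ω * (prinEvent S).indicator 1 ω) *
      expect p (fun ω => 1 - (prinEvent S).indicator 1 ω) +
    expect p (fun ω => F₀ ω * G₀ ω * (1 - (prinEvent S).indicator 1 ω)) *
      expect p (fun ω => (prinEvent S).indicator 1 ω) -
    expect p (fun ω => F₁ ω * (prinEvent S).indicator 1 ω) *
      expect p (fun ω => G₀ ω * (1 - (prinEvent S).indicator 1 ω)) -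
    expect p (fun ω => F₀ ω * (1 - (prinEvent S).indicator 1 ω)) *
      expect p (fun ω => G₁ ω * (prinEvent S).indicator 1 ω)

omit [LinearOrder R] [IsStrictOrderedRing R] in
/-- Pinning `i ∈ S` in a complementary weight: `E_p[Y·(1 − 1_{A_S}·[ω i])] = p_i·E¹[Y·(1 − 1_{A_S})] +
(1 − p_i)·E⁰[Y]`. -/
lemma expect_mul_one_sub_pin (p : E → R) (i : E) (I Y : Config E → R) :
    expect p (fun ω => Y ω * (1 - I ω * (if ω i = true then 1 else 0))) =
      p i * expect (Function.update p i 1) (fun ω => Y ω * (1 - I ω)) +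
        (1 - p i) * expect (Function.update p i 0) Y := by
  have e : (fun ω => Y ω * (1 - I ω * (if ω i = true then 1 else 0))) =
      Y - fun ω => Y ω * I ω * (if ω i = true then 1 else 0) := by
    funext ω; simp only [Pi.sub_apply]; ring
  have e' : (fun ω => Y ω * (1 - I ω)) = Y - fun ω => Y ω * I ω := by
    funext ω; simp only [Pi.sub_apply]; ring
  rw [e, e', expect_sub, expect_sub, expect_mul_open_eq p i (fun ω => Y ω * I ω),
    expect_eq_pin p Y i]
  ring

/-- **The nested mixed split form is nonnegative for principal up-sets** (induction on `S`; the
cross term is the nested (PS1) form). -/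
theorem splitForm_nonneg (S : Finset E) :
    ∀ (p : E → R), IsProbVec p → ∀ (F₁ G₁ F₀ G₀ : Config E → R), Monotone F₁ → Monotone G₁ →
      Monotone F₀ → Monotone G₀ → (∀ ω, F₀ ω ≤ F₁ ω) → (∀ ω, G₀ ω ≤ G₁ ω) →
        0 ≤ splitForm p S F₁ G₁ F₀ G₀ := by
  induction S using Finset.induction_on with
  | empty =>
    intro p hp F₁ G₁ F₀ G₀ _ _ _ _ _ _
    unfold splitForm
    simp only [indicator_prinEvent_empty, sub_self, mul_zero, mul_one, expect_const]
    simp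
  | insert i S hi ih =>
    intro p hp F₁ G₁ F₀ G₀ h1 h2 h3 h4 h10 h20
    have hp₁ : IsProbVec (Function.update p i 1) := hp.update i zero_le_one le_rfl
    have hq0 := hp.nonneg i
    have hq1 := hp.le_one i
    have ih₁ := ih (Function.update p i 1) hp₁ F₁ G₁ F₀ G₀ h1 h2 h3 h4 h10 h20
    have hN := nestedForm_nonneg S (Function.update p i 1) hp₁ F₁ G₁
      (fun ω => F₀ (Function.update ω i false)) (fun ω => G₀ (Function.update ω i false)) h1 h2
      (monotone_comp_update_false h3 i) (monotone_comp_update_false h4 i)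
      (fun ω => le_trans (h3 (update_false_le ω i)) (h10 ω))
      (fun ω => le_trans (h4 (update_false_le ω i)) (h20 ω))
    unfold splitForm at ih₁ ⊢
    unfold nestedForm at hN
    rw [expect_update_one_comp_update_false p i (fun ω => F₀ ω * G₀ ω),
      expect_update_one_comp_update_false p i F₀,
      expect_update_one_comp_update_false p i G₀] at hN
    simp only [indicator_prinEvent_insert, ← mul_assoc]
    rw [expect_mul_open_eq p i (fun ω => F₁ ω * G₁ ω * (prinEvent S).indicator 1 ω),
      expect_mul_open_eq p i (fun ω => F₁ ω * (prinEvent S).indicator 1 ω),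
      expect_mul_open_eq p i (fun ω => G₁ ω * (prinEvent S).indicator 1 ω),
      expect_mul_open_eq p i (fun ω => (prinEvent S).indicator 1 ω)]
    have c1 := expect_mul_one_sub_pin p i ((prinEvent S).indicator 1) (fun _ => (1 : R))
    have c2 := expect_mul_one_sub_pin p i ((prinEvent S).indicator 1) (fun ω => F₀ ω * G₀ ω)
    have c3 := expect_mul_one_sub_pin p i ((prinEvent S).indicator 1) G₀
    have c4 := expect_mul_one_sub_pin p i ((prinEvent S).indicator 1) F₀
    simp only [one_mul] at c1
    rw [c1, c2, c3, c4]
    simp only [expect_const]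
    set q := p i
    set u₁ := expect (Function.update p i 1) (fun ω => F₁ ω * G₁ ω * (prinEvent S).indicator 1 ω)
    set P := expect (Function.update p i 1) (fun ω => (prinEvent S).indicator 1 ω)
    set P' := expect (Function.update p i 1) (fun ω => 1 - (prinEvent S).indicator 1 ω)
    set a₁ := expect (Function.update p i 1) (fun ω => F₁ ω * (prinEvent S).indicator 1 ω)
    set c₁ := expect (Function.update p i 1) (fun ω => G₁ ω * (prinEvent S).indicator 1 ω)
    set w₁ := expect (Function.update p i 1) (fun ω => F₀ ω * G₀ ω * (1 - (prinEvent S).indicator 1 ω))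
    set w₀ := expect (Function.update p i 0) (fun ω => F₀ ω * G₀ ω)
    set b₁ := expect (Function.update p i 1) (fun ω => F₀ ω * (1 - (prinEvent S).indicator 1 ω))
    set b₀ := expect (Function.update p i 0) F₀
    set d₁ := expect (Function.update p i 1) (fun ω => G₀ ω * (1 - (prinEvent S).indicator 1 ω))
    set d₀ := expect (Function.update p i 0) G₀
    have key : q * u₁ * (q * P' + (1 - q) * 1) + (q * w₁ + (1 - q) * w₀) * (q * P) -
        q * a₁ * (q * d₁ + (1 - q) * d₀) - (q * b₁ + (1 - q) * b₀) * (q * c₁) =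
        q * (q * (u₁ * P' + w₁ * P - a₁ * d₁ - b₁ * c₁) +
          (1 - q) * (u₁ + w₀ * P - a₁ * d₀ - b₀ * c₁)) := by
      ring
    rw [key]
    exact mul_nonneg hq0 (add_nonneg (mul_nonneg hq0 ih₁) (mul_nonneg (by linarith) hN))

/-- **(PS)-shape for principal up-sets**: `E[FG·1_A]·P(Ā) + E[FG·1_Ā]·P(A) ≥ E[F·1_A]·E[G·1_Ā] +
E[F·1_Ā]·E[G·1_A]` for monotone `F, G`, `A = A_S`, `1_Ā = 1 − 1_A`. -/
theorem pointSplit_principal {p : E → R} (hp : IsProbVec p) (S : Finset E)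
    {F G : Config E → R} (hF : Monotone F) (hG : Monotone G) :
    expect p (fun ω => F ω * (prinEvent S).indicator 1 ω) *
          expect p (fun ω => G ω * (1 - (prinEvent S).indicator 1 ω)) +
        expect p (fun ω => F ω * (1 - (prinEvent S).indicator 1 ω)) *
          expect p (fun ω => G ω * (prinEvent S).indicator 1 ω) ≤
      expect p (fun ω => F ω * G ω * (prinEvent S).indicator 1 ω) *
          expect p (fun ω => 1 - (prinEvent S).indicator 1 ω) +
        expect p (fun ω => F ω * G ω * (1 - (prinEvent S).indicator 1 ω)) *
          expect p (fun ω => (prinEvent S).indicator 1 ω) := by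
  have h := splitForm_nonneg S p hp F G F G hF hG hF hG (fun _ => le_rfl) (fun _ => le_rfl)
  unfold splitForm at h
  linarith [h]

end PointSplit

end CovForm

end Summit.Ventures.PercRepro2
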